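import Summits.ResolutionOfSingularities.ResolutionOfSingularities.Theorems.WeightedInvariantIota3JSigmaDominanceUpgrade
import Summits.ResolutionOfSingularities.ResolutionOfSingularities.Theorems.WeightedInvariantIota3SigmaAscent
import Summits.ResolutionOfSingularities.ResolutionOfSingularities.Theorems.WeightedInvariantIota3FlagTools
import Summits.ResolutionOfSingularities.ResolutionOfSingularities.Theorems.WeightedInvariantIotaOrderEssSmooth
import HarnessLib

/-!
# «LEMMA R»: a two-flag filtration whose two defining levels are EXTENDED ideals is the filtration of a RATIONAL two-flag
# (door `HypersurfaceCentreConstruction`, stmt-ResolutionOfSingularities-19897; P3 rung (c11σ)/(o53-desc′) — the last step of every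
# σ-maximiser-descent route; hand res-L1-w43-stub-3)

Topic: `Summits/ResolutionOfSingularities/ResolutionOfSingularities/Theorems`. Helper for the door item
`HypersurfaceCentreConstruction` (stmt-ResolutionOfSingularities-19897, route `WeightedInvariant`), line `local-engine` (L W4.3),
def-free.

**Setting.** `φ : S → S'` a local homomorphism of local rings, flat, with `𝔪_S S' = 𝔪_{S'}`; `(g₁', g₂')` a two-flag of `S'`,
`(q; r₁, r₂)` admissible, `F'(n) = flagContactFiltration g₁' g₂' q r₁ r₂ n`.

**What is proved** (`exists_isTwoFlag_eq_of_extended`).  If the two defining levels are extended from `S` — `F'(r₁) = I₁ S'`,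
`F'(r₂) = I₂ S'` for ideals `I₁, I₂ ⊆ S` — then there is a two-flag `(g₁, g₂)` OF `S`, `g₁ ∈ I₁`, `g₂ ∈ I₂`, with
`flagContactFiltration (φ g₁) (φ g₂) q r₁ r₂ n = F'(n)` for EVERY `n`; in particular every reach of `(g₁', g₂')` by an `φ f`
descends to a reach of `f` by `(g₁, g₂)` (`flagReaches_of_extended`).  Only the two levels `r₁, r₂` matter: by res-D-brk-1's UPGRADE
LEMMA (p565670 `Iota3.flagContactFiltration_eq_of_oneSided`: a two-flag sitting one-sidedly in another flag's filtration at the two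
defining levels defines the SAME filtration) it suffices to find a two-flag `(g₁, g₂)` of `S` inside `I₁ × I₂`; and that is residue
linear algebra: `I₁ ⊄ 𝔪_S²` (else `g₁' ∈ F'(r₁) = I₁S' ⊆ 𝔪'²`), and `I₂ ⊄ (g₁) + 𝔪_S²` (else `g₁', g₂' ∈ (φg₁) + 𝔪'²`, and
eliminating `φg₁` from the two expressions contradicts the two-flag property of `(g₁', g₂')`).

**Why this is the right cut** (memo O53-DESC-CEX / O53-DESC-PART1 §4).  Two-flag reach does NOT descend in general along finite étale
maps (`f = w³ + Q(u,v)²`); what CAN descend is a filtration that is defined over `S` — e.g. the σ-maximiser filtration once (J-can)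
((o70-b)) makes it canonical and a Galois / descent argument makes its levels extended.  This file isolates the extended ⇒ rational
step, free of any Galois theory and of maximality.

[OURS · L1 W4.3 · (o53-desc′)]  Replaces the role of NO printed item; NOT a statement of the manuscript [claim: Hironaka2017,
status: under-review]. AI work, weaker than expert review.  No named facts.

## References

* H. Hironaka, *Characteristic polyhedra of singularities*, J. Math. Kyoto Univ. 7 (1967), §3. [Hironaka1967]
* A. Grothendieck, *EGA IV*, Publ. Math. IHÉS 20 (1964), 0_IV (19.7.1). [EGA0IV]
-/

noncomputable section

open IsLocalRing Literature.AlgebraicGeometry.Resolution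
open Summit.ResolutionOfSingularities.ResolutionOfSingularities.Cruxes.HypersurfaceCentreConstruction.LocalEngine
open Summit.ResolutionOfSingularities.ResolutionOfSingularities.Cruxes.HypersurfaceCentreConstruction.LocalEngine.Iota3

set_option linter.dupNamespace false -- mandated namespace of this single-conjunct summit

namespace Summit.ResolutionOfSingularities.ResolutionOfSingularities.Theorems

namespace JFlatEssSmooth

section Extended

variable {S S' : Type} [CommRing S] [CommRing S'] [IsLocalRing S] [IsLocalRing S'] [Algebra S S'] [Module.Flat S S']

omit [Module.Flat S S'] in
/-- A two-flag filtration lies in `𝔪` in every positive degree. [folklore] -/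
theorem flagContactFiltration_le_maximalIdeal_of_pos {g₁ g₂ : S'} (hg₁ : g₁ ∈ maximalIdeal S') (hg₂ : g₂ ∈ maximalIdeal S')
    {q : ℕ} (hq : 0 < q) (r₁ r₂ : ℕ) {n : ℕ} (hn : 0 < n) : flagContactFiltration g₁ g₂ q r₁ r₂ n ≤ maximalIdeal S' := by
  rw [flagContactFiltration_def]
  refine iSup_le fun α => iSup_le fun β => ?_
  rcases Nat.eq_zero_or_pos α with rfl | hα
  · rcases Nat.eq_zero_or_pos β with rfl | hβ
    · rw [pow_zero, pow_zero, mul_one, Ideal.span_singleton_one, Ideal.top_mul, Nat.mul_zero, Nat.mul_zero, Nat.sub_zero,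
        Nat.sub_zero]
      exact Ideal.pow_le_self (Nat.pos_iff_ne_zero.mp (Nat.div_pos (by omega) hq))
    · refine le_trans Ideal.mul_le_right ?_
      rw [Ideal.span_singleton_le_iff_mem, pow_zero, one_mul]
      obtain ⟨k, rfl⟩ := Nat.exists_eq_succ_of_ne_zero hβ.ne'
      rw [pow_succ]
      exact Ideal.mul_mem_left _ _ hg₂
  · refine le_trans Ideal.mul_le_right ?_
    rw [Ideal.span_singleton_le_iff_mem]
    obtain ⟨k, rfl⟩ := Nat.exists_eq_succ_of_ne_zero hα.ne'
    rw [pow_succ, mul_assoc, mul_comm g₁, ← mul_assoc]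
    exact Ideal.mul_mem_left _ _ hg₁

omit [Module.Flat S S'] in
/-- **A two-flag of `S` inside `I₁ × I₂`** when `I₁ S' ∋ g₁'` and `I₂ S' ∋ g₁', g₂'` for a two-flag `(g₁', g₂')` of `S'`
(`φ` flat local with `𝔪S' = 𝔪'`): residue linear algebra + faithful flatness. [folklore] -/
theorem exists_isTwoFlag_mem_of_map (h𝔪 : (maximalIdeal S).map (algebraMap S S') = maximalIdeal S')
    {g₁' g₂' : S'} (hfl' : IsTwoFlag g₁' g₂') {I₁ I₂ : Ideal S} (hI₁ : I₁ ≤ maximalIdeal S) (hI₂ : I₂ ≤ maximalIdeal S)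
    (h₁ : g₁' ∈ I₁.map (algebraMap S S')) (h₁₂ : g₁' ∈ I₂.map (algebraMap S S')) (h₂ : g₂' ∈ I₂.map (algebraMap S S')) :
    ∃ g₁ g₂ : S, IsTwoFlag g₁ g₂ ∧ g₁ ∈ I₁ ∧ g₂ ∈ I₂ := by
  have hsq : (maximalIdeal S ^ 2).map (algebraMap S S') = maximalIdeal S' ^ 2 := by rw [Ideal.map_pow, h𝔪]
  have hg₁'2 : g₁' ∉ maximalIdeal S' ^ 2 := hfl'.left_not_mem_sq
  -- Claim A: some `g₁ ∈ I₁` has `φ g₁ ∉ 𝔪'²`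
  obtain ⟨g₁, hg₁I, hg₁2⟩ : ∃ g₁ ∈ I₁, algebraMap S S' g₁ ∉ maximalIdeal S' ^ 2 := by
    by_contra hcon
    push Not at hcon
    have hle : I₁.map (algebraMap S S') ≤ maximalIdeal S' ^ 2 := by
      rw [Ideal.map_le_iff_le_comap]
      exact fun x hx => hcon x hx
    exact hg₁'2 (hle h₁)
  -- Claim B: some `g₂ ∈ I₂` lies outside `(g₁) + 𝔪²`
  obtain ⟨g₂, hg₂I, hg₂out⟩ : ∃ g₂ ∈ I₂, g₂ ∉ Ideal.span {g₁} ⊔ maximalIdeal S ^ 2 := by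
    by_contra hcon
    push Not at hcon
    have hle : I₂.map (algebraMap S S') ≤ Ideal.span {algebraMap S S' g₁} ⊔ maximalIdeal S' ^ 2 := by
      rw [Ideal.map_le_iff_le_comap]
      intro x hx
      obtain ⟨a, ha, m, hm, hax⟩ := Submodule.mem_sup.mp (hcon x hx)
      obtain ⟨c, rfl⟩ := Ideal.mem_span_singleton'.mp ha
      rw [Ideal.mem_comap, ← hax, map_add, map_mul]
      exact Submodule.add_mem_sup (Ideal.mem_span_singleton'.mpr ⟨_, rfl⟩) (hsq ▸ Ideal.mem_map_of_mem _ hm)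
    -- `g₁' = a φg₁ + m₁`, `g₂' = b φg₁ + m₂`
    obtain ⟨a₁, ha₁, m₁, hm₁, he₁⟩ := Submodule.mem_sup.mp (hle h₁₂)
    obtain ⟨a, rfl⟩ := Ideal.mem_span_singleton'.mp ha₁
    obtain ⟨a₂, ha₂, m₂, hm₂, he₂⟩ := Submodule.mem_sup.mp (hle h₂)
    obtain ⟨b, rfl⟩ := Ideal.mem_span_singleton'.mp ha₂
    -- `b g₁' - a g₂' = b m₁ - a m₂ ∈ 𝔪'²` ⇒ `a, b ∈ 𝔪'` ⇒ `g₁' ∈ 𝔪'²`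
    have hrel : b * g₁' + (-a) * g₂' ∈ maximalIdeal S' ^ 2 := by
      have : b * g₁' + (-a) * g₂' = b * m₁ - a * m₂ := by rw [← he₁, ← he₂]; ring
      rw [this]
      exact Ideal.sub_mem _ (Ideal.mul_mem_left _ _ hm₁) (Ideal.mul_mem_left _ _ hm₂)
    obtain ⟨-, ha⟩ := hfl'.2.2 b (-a) hrel
    have ha' : a ∈ maximalIdeal S' := by simpa using ha
    apply hg₁'2
    rw [← he₁, pow_two]
    refine Ideal.add_mem _ ?_ (by rw [← pow_two]; exact hm₁)
    exact Ideal.mul_mem_mul ha' (h𝔪 ▸ Ideal.mem_map_of_mem _ (hI₁ hg₁I))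
  refine ⟨g₁, g₂, ⟨hI₁ hg₁I, hI₂ hg₂I, fun a b hab => ?_⟩, hg₁I, hg₂I⟩
  -- independence of the residues of `g₁, g₂`
  have hg₁2' : g₁ ∉ maximalIdeal S ^ 2 := fun h => hg₁2 (hsq ▸ Ideal.mem_map_of_mem _ h)
  have hb : b ∈ maximalIdeal S := by
    by_contra hbu
    obtain ⟨v, hv⟩ := (IsLocalRing.mem_maximalIdeal b).not.mp hbu |> not_not.mp
    apply hg₂out
    -- `g₂ = v⁻¹ (a g₁ + b g₂) - v⁻¹ a g₁`
    have : g₂ = -(↑v⁻¹ * a) * g₁ + ↑v⁻¹ * (a * g₁ + b * g₂) := by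
      rw [← hv, mul_add, ← mul_assoc (↑v⁻¹ : S) (v : S), Units.inv_mul, one_mul]; ring
    rw [this]
    exact Submodule.add_mem_sup (Ideal.mem_span_singleton'.mpr ⟨_, rfl⟩) (Ideal.mul_mem_left _ _ hab)
  have ha : a ∈ maximalIdeal S := by
    by_contra hau
    obtain ⟨v, hv⟩ := (IsLocalRing.mem_maximalIdeal a).not.mp hau |> not_not.mp
    apply hg₁2'
    have hbg : b * g₂ ∈ maximalIdeal S ^ 2 := by
      rw [pow_two]; exact Ideal.mul_mem_mul hb (hI₂ hg₂I)
    have : g₁ = ↑v⁻¹ * ((a * g₁ + b * g₂) - b * g₂) := by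
      rw [add_sub_cancel_right, ← mul_assoc, ← hv, Units.inv_mul, one_mul]
    rw [this]
    exact Ideal.mul_mem_left _ _ (Ideal.sub_mem _ hab hbg)
  exact ⟨ha, hb⟩

/-- **«LEMMA R» — EXTENDED LEVELS ⇒ RATIONAL TWO-FLAG.**  `φ : S → S'` flat local with `𝔪S' = 𝔪'`, `(g₁', g₂')` a two-flag of
`S'`, `(q; r₁, r₂)` admissible; if `F'(r₁) = I₁ S'` and `F'(r₂) = I₂ S'` for ideals `I₁, I₂` of `S`, then a two-flag `(g₁, g₂)` of
`S` with `g₁ ∈ I₁`, `g₂ ∈ I₂` has `flagContactFiltration (φ g₁) (φ g₂) q r₁ r₂ n = F'(n)` for all `n` (res-D-brk-1's UPGRADE LEMMA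
p565670 does the filtration comparison). [cite: Hironaka1967, §3] [OURS · L1 W4.3 · (o53-desc′)] -/
theorem exists_isTwoFlag_eq_of_extended (h𝔪 : (maximalIdeal S).map (algebraMap S S') = maximalIdeal S')
    {g₁' g₂' : S'} (hfl' : IsTwoFlag g₁' g₂') {q r₁ r₂ : ℕ} (hadm : AdmissibleTriple q r₁ r₂) {I₁ I₂ : Ideal S}
    (hI₁ : I₁.map (algebraMap S S') = flagContactFiltration g₁' g₂' q r₁ r₂ r₁)
    (hI₂ : I₂.map (algebraMap S S') = flagContactFiltration g₁' g₂' q r₁ r₂ r₂) :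
    ∃ g₁ g₂ : S, IsTwoFlag g₁ g₂ ∧ g₁ ∈ I₁ ∧ g₂ ∈ I₂ ∧
      ∀ n, flagContactFiltration (algebraMap S S' g₁) (algebraMap S S' g₂) q r₁ r₂ n =
        flagContactFiltration g₁' g₂' q r₁ r₂ n := by
  haveI : IsLocalHom (algebraMap S S') := isLocalHom_of_map_maximalIdeal_eq h𝔪
  have hself := self_mem_flagContactFiltration g₁' g₂' r₁ r₂ hadm.1
  have hF'le : ∀ n, 0 < n → flagContactFiltration g₁' g₂' q r₁ r₂ n ≤ maximalIdeal S' := fun n hn =>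
    flagContactFiltration_le_maximalIdeal_of_pos hfl'.1 hfl'.2.1 hadm.1 r₁ r₂ hn
  have hr₂ : 0 < r₂ := lt_of_lt_of_le hadm.1 hadm.2.1
  have hr₁ : 0 < r₁ := lt_of_lt_of_le hr₂ hadm.2.2
  -- `I₁, I₂ ⊆ 𝔪` (faithful flatness: `I S' ⊆ 𝔪'` ⇒ `I ⊆ 𝔪`)
  have hIle : ∀ {I : Ideal S} {n : ℕ}, 0 < n → I.map (algebraMap S S') = flagContactFiltration g₁' g₂' q r₁ r₂ n →
      I ≤ maximalIdeal S := by
    intro I n hn hI x hx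
    have hx' : algebraMap S S' x ∈ maximalIdeal S' := hF'le n hn (hI ▸ Ideal.mem_map_of_mem _ hx)
    exact (IsLocalRing.mem_maximalIdeal _).mpr fun hu =>
      (IsLocalRing.mem_maximalIdeal _).mp hx' ((isUnit_map_iff (algebraMap S S') x).mpr hu)
  obtain ⟨g₁, g₂, hfl, hg₁, hg₂⟩ := exists_isTwoFlag_mem_of_map h𝔪 hfl' (hIle hr₁ hI₁) (hIle hr₂ hI₂)
    (hI₁ ▸ hself.1) (hI₂ ▸ flagContactFiltration_antitone g₁' g₂' q r₁ r₂ hadm.2.2 hself.1) (hI₂ ▸ hself.2)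
  refine ⟨g₁, g₂, hfl, hg₁, hg₂, fun n => ?_⟩
  exact (flagContactFiltration_eq_of_oneSided (hfl.algebraMap_of_flat h𝔪) hadm hfl'.1 hfl'.2.1
    (hI₁ ▸ Ideal.mem_map_of_mem _ hg₁) (hI₂ ▸ Ideal.mem_map_of_mem _ hg₂) n).symm

/-- **Reach descends through extended levels**: if `φ f` is carried to `(q; r₁, r₂)` by a two-flag of `S'` whose levels `r₁, r₂`
are extended from `S`, then `f` is carried to `(q; r₁, r₂)` by a two-flag of `S`. [cite: Hironaka1967, §3] [cite: EGA0IV, 0_IV (19.7.1)]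
[OURS · L1 W4.3 · (o53-desc′)] -/
theorem flagReaches_of_extended (h𝔪 : (maximalIdeal S).map (algebraMap S S') = maximalIdeal S')
    {g₁' g₂' : S'} (hfl' : IsTwoFlag g₁' g₂') {q r₁ r₂ : ℕ} (hadm : AdmissibleTriple q r₁ r₂) {I₁ I₂ : Ideal S}
    (hI₁ : I₁.map (algebraMap S S') = flagContactFiltration g₁' g₂' q r₁ r₂ r₁)
    (hI₂ : I₂.map (algebraMap S S') = flagContactFiltration g₁' g₂' q r₁ r₂ r₂) {f : S} {ν : ℕ}
    (hf : algebraMap S S' f ∈ flagContactFiltration g₁' g₂' q r₁ r₂ (r₁ * ν)) : FlagReaches f ν q r₁ r₂ := by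
  obtain ⟨g₁, g₂, hfl, -, -, heq⟩ := exists_isTwoFlag_eq_of_extended h𝔪 hfl' hadm hI₁ hI₂
  refine ⟨g₁, g₂, hfl, ?_⟩
  rw [← heq, ← map_flagContactFiltration_eq (algebraMap S S') h𝔪] at hf
  exact (mem_iff_algebraMap_mem_map_of_flat h𝔪 _ f).mpr hf

end Extended

end JFlatEssSmooth

end Summit.ResolutionOfSingularities.ResolutionOfSingularities.Theorems

end
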